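import Summits.BirchSwinnertonDyer.BirchSwinnertonDyer.Theorems.SignedLowerHalvesKobayashiLowerHalfLargeImageParityStratumFE
import Summits.BirchSwinnertonDyer.BirchSwinnertonDyer.Theorems.SignedLowerHalvesKobayashiLowerHalfLargeImageMuFloorSupply
import Summits.BirchSwinnertonDyer.Rank1Residual.X11a.MuLambdaSplit
import HarnessLib

/-!
# Route `SignedLowerHalves`, crux 3 `KobayashiLowerHalfLargeImage` (item stmt-BirchSwinnertonDyer-19001):
# the PARITY STRATUM meets the μ-FLOOR — at `p = 3` the two-part certificate `(μ, λ)(L^ε_3) = (0, ≤ 1)` of the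
# parity stratum shrinks to the ONE-PART certificate «`λ ≤ 1` at a unit-content sign», because one sign with
# `μ(L^ε_3) = 0` EXISTS for every curve good at `3` with `a₃ = 0` (THEOREM B road); at `p ≥ 5` the same ⟸ B⁰
# (cell `bsd-ssimc`, width seat `bsd-line-slh-p1-w2` gen 5, file 4; helper `--supports 19001`)

HONEST FRAMING: the crux is OPEN and nothing here proves it; BSD is not proved by any of this. THEOREMS ONLY
(no `def`, no named fact, no `sorry`). CALIBRATION / SUPPORT ONLY (pen rule D34-4 (3)): never an input to a
registered stub, a `closes`, or a by-name close of item 19001. Composes the LEAD's parity stratum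
(`LargeImageParityStratum.kobayashiLowerDivisibility_of_lam_le_one'`, gen 12, Sprung's functional equation fed by
its tree proof) with the μ-floor (`SmallImageCycWindingMuThree.exists_sign_hasUnitContent_three_of_isNewformOf`,
slh-p3, input-free at `3`; `SmallImageTeichOrbitMu.exists_sign_hasUnitContent_of_teichSpanGenAll` ⟸ B⁰ at `p ≥ 5`).

* §1 `kobayashiLowerDivisibility_of_isSignedPAdicLFunction_of_hasUnitContent_of_lam_le_one` — for a sign `ε` and ONE
  `L ∈ Λ` with the parity-`ε` congruences, unit content and `λ(L) ≤ 1`: `KobayashiLowerDivisibility W p ε`, granted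
  `h12` (Kobayashi Thm. 1.2), `h5`/`h3` (periods), `hpar` (`p`-parity, Dokchitser–Dokchitser) — the stratum's
  certificate read on ONE `L` (uniqueness `IsSignedPAdicLFunction.unique`; `μ = 0` from unit content).
* §2 **`p = 3`**: `exists_kobayashiLowerDivisibility_three_of_lam_le_one_at_unitSign` — for every `W` good at `3` with
  `a₃ = 0`: if `λ(L) ≤ 1` for every signed `3`-adic `L`-function `L` of the newform WITH UNIT CONTENT (a hypothesis
  that bites at the sign(s) the μ-floor provides, and is vacuous at a sign with `μ > 0`), then
  `∃ ε, KobayashiLowerDivisibility W 3 ε`, granted `h12`, `h5`, `h3`, `hpar`. The μ-clause of the certificate is GONE.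
* §3 **`p ≥ 5` ⟸ B⁰** (`TeichSpanGenAll`, OPEN, displayed): the same; and the X7 corner forms for the LEAD.

Reading for the dossier census: at the 2608 `p = 3` pairs of the crux's X7 window the open set inside the cone is
now «`λ(L^ε_3) ≥ 2` at EVERY unit-content sign `ε`» (paired / deep zeros), no longer «… or `μ ≥ 1` for both signs».

References: [Kobayashi2003] Thm. 1.2, Conjecture (p. 2); [DokchitserDokchitserAnnals2010] Thm. 1.4; [Sprung2017]
Cor. 4.14; [GreenbergVatsal2000] p. 2 (2), §3 Remark 3.4; [Vaserstein1972SL2] Theorem; [PollackWeston2011]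
Thm. 4.1 (1), Rem. 4.2; [Manin1972] Prop. 1.4 (B⁰'s vocabulary).
-/

set_option autoImplicit false
set_option linter.dupNamespace false

noncomputable section

open scoped Classical MatrixGroups ModularForm

open CongruenceSubgroup WeierstrassCurve Literature.NumberTheory.EllipticCurves
  Literature.NumberTheory.EllipticCurves.ModularForms
  Literature.NumberTheory.EllipticCurves.Rank1Residual
  Literature.NumberTheory.EllipticCurves.Rank1Residual.Typed
  Literature.NumberTheory.EllipticCurves.GreenbergVatsal2000
  Literature.NumberTheory.EllipticCurves.Kobayashi2003 ZpExtension
  Summit.BirchSwinnertonDyer.Rank1Residual.X1.MuLambda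
  Summit.BirchSwinnertonDyer.Rank1Residual.Supersingular
  Summit.BirchSwinnertonDyer.BirchSwinnertonDyer.Theorems.LargeImageParityStratum
  Summit.BirchSwinnertonDyer.BirchSwinnertonDyer.Theorems.SmallImageCycWindingMuThree
  Summit.BirchSwinnertonDyer.BirchSwinnertonDyer.Theorems.SmallImageTeichOrbitMu
  Summit.BirchSwinnertonDyer.BirchSwinnertonDyer.Cruxes.AnalyticMuZeroX9.TeichSpan

namespace Summit.BirchSwinnertonDyer.BirchSwinnertonDyer.Theorems.HorocycleMuFloor

variable (W : WeierstrassCurve ℚ) [W.IsElliptic] [W.IsGloballyMinimal] (p : ℕ) [hp : Fact p.Prime]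

/-! ## §1. The stratum's certificate read on ONE signed function with unit content -/

/-- **`KobayashiLowerDivisibility W p ε` from ONE signed function with unit content and `λ ≤ 1`.** Odd good `p`,
`a_p = 0`, `f₀` the newform of level `N_E`; `L ∈ Λ` with `IsSignedPAdicLFunction f₀ p ε L`, `HasUnitContent L`,
`lam L ≤ 1`; granted `h12`, `h5`, `h3`, `hpar` BY NAME. (Every `L'` with the same congruences equals `L` —
`IsSignedPAdicLFunction.unique` — so the stratum's `∀ L', μ(L') = 0 ∧ λ(L') ≤ 1` holds.)
[cite: Kobayashi2003, Thm. 1.2 (p. 2) and Conjecture (p. 2)] [cite: DokchitserDokchitserAnnals2010, Thm. 1.4]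
[cite: GreenbergVatsal2000, p. 2 (2) and §3 Remark 3.4] -/
theorem kobayashiLowerDivisibility_of_isSignedPAdicLFunction_of_hasUnitContent_of_lam_le_one
    (h12 : Kobayashi2003.thm12_signedSelmerDual_finite_torsion)
    (h5 : realPeriodRat_eq_unit_mul_plusPeriod) (h3 : realPeriodRat_eq_unit_mul_plusPeriod_three)
    (hpar : p_parity W p) (hp2 : p ≠ 2) (hgood : W.HasGoodReductionAtPrime p) (hap : W.frobeniusTrace p = 0)
    [NeZero (W.conductorNorm ℤ)] {f₀ : CuspForm (Gamma0 (W.conductorNorm ℤ)) 2} (hf₀ : IsNewformOf W f₀)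
    {ε : ℤˣ} {L : IwasawaAlgebra p} (hL : IsSignedPAdicLFunction f₀ p ε L) (hu : HasUnitContent L)
    (hlam : lam L ≤ 1) : KobayashiLowerDivisibility W p ε :=
  kobayashiLowerDivisibility_of_lam_le_one' W p h12 h5 h3 hpar hp2 hgood hap ε hf₀ fun L' hL' ↦ by
    rw [hL'.unique hL]
    exact ⟨Summit.BirchSwinnertonDyer.Rank1Residual.X11a.mu_eq_zero_of_hasUnitContent hu, hlam⟩

/-- **From a rider `∃ ε L, IsSignedPAdicLFunction f₀ p ε L ∧ HasUnitContent L` and the ONE-PART certificate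
«`λ ≤ 1` at every unit-content signed function» to the crux's conclusion at the pair.**
[cite: Kobayashi2003, Thm. 1.2 (p. 2) and Conjecture (p. 2)] [cite: DokchitserDokchitserAnnals2010, Thm. 1.4] -/
theorem exists_kobayashiLowerDivisibility_of_rider_of_lam_le_one_at_unitSign
    (h12 : Kobayashi2003.thm12_signedSelmerDual_finite_torsion)
    (h5 : realPeriodRat_eq_unit_mul_plusPeriod) (h3 : realPeriodRat_eq_unit_mul_plusPeriod_three)
    (hpar : p_parity W p) (hp2 : p ≠ 2) (hgood : W.HasGoodReductionAtPrime p) (hap : W.frobeniusTrace p = 0)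
    [NeZero (W.conductorNorm ℤ)] {f₀ : CuspForm (Gamma0 (W.conductorNorm ℤ)) 2} (hf₀ : IsNewformOf W f₀)
    (hrider : ∃ (ε : ℤˣ) (L : IwasawaAlgebra p), IsSignedPAdicLFunction f₀ p ε L ∧ HasUnitContent L)
    (hlamU : ∀ (ε : ℤˣ) (L : IwasawaAlgebra p), IsSignedPAdicLFunction f₀ p ε L → HasUnitContent L → lam L ≤ 1) :
    ∃ ε : ℤˣ, KobayashiLowerDivisibility W p ε := by
  obtain ⟨ε, L, hL, hu⟩ := hrider
  exact ⟨ε, kobayashiLowerDivisibility_of_isSignedPAdicLFunction_of_hasUnitContent_of_lam_le_one W p h12 h5 h3 hpar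
    hp2 hgood hap hf₀ hL hu (hlamU ε L hL hu)⟩

/-! ## §2. `p = 3`: the μ-clause of the certificate is GONE -/

/-- **`p = 3`, every curve good at `3` with `a₃ = 0`: `∃ ε, KobayashiLowerDivisibility W 3 ε` from the ONE-PART
certificate «`λ(L) ≤ 1` for every signed `3`-adic `L`-function `L` of the newform with unit content»**, granted
`h12`, `h5`, `h3`, `hpar` BY NAME. The sign is supplied by the INPUT-FREE μ-floor
(`exists_sign_hasUnitContent_three_of_isNewformOf`: THEOREM B road on Vaserstein's theorem). The hypothesis is
vacuous at a sign with `μ > 0`, so it is strictly weaker than the stratum's `(μ, λ) = (0, ≤ 1)` certificate.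
[cite: Kobayashi2003, Thm. 1.2 (p. 2) and Conjecture (p. 2)] [cite: DokchitserDokchitserAnnals2010, Thm. 1.4]
[cite: Vaserstein1972SL2, Theorem] [cite: PollackWeston2011, Thm. 4.1 (1), Rem. 4.2] -/
theorem exists_kobayashiLowerDivisibility_three_of_lam_le_one_at_unitSign
    (h12 : Kobayashi2003.thm12_signedSelmerDual_finite_torsion)
    (h5 : realPeriodRat_eq_unit_mul_plusPeriod) (h3 : realPeriodRat_eq_unit_mul_plusPeriod_three)
    (hpar : p_parity W 3) (hgood : W.HasGoodReductionAtPrime 3) (hap : W.frobeniusTrace 3 = 0)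
    [NeZero (W.conductorNorm ℤ)] {f₀ : CuspForm (Gamma0 (W.conductorNorm ℤ)) 2} (hf₀ : IsNewformOf W f₀)
    (hlamU : ∀ (ε : ℤˣ) (L : IwasawaAlgebra 3), IsSignedPAdicLFunction f₀ 3 ε L → HasUnitContent L → lam L ≤ 1) :
    ∃ ε : ℤˣ, KobayashiLowerDivisibility W 3 ε :=
  exists_kobayashiLowerDivisibility_of_rider_of_lam_le_one_at_unitSign W 3 h12 h5 h3 hpar (by decide) hgood hap hf₀
    (exists_sign_hasUnitContent_three_of_isNewformOf f₀ hf₀ hgood hap) hlamU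

/-- The same on the crux's corner with its binders displayed (class X7 at `3`, `a₃ = 0`; `¬CM`, `Surj` idle).
[cite: Kobayashi2003, Thm. 1.2 and Conjecture (p. 2)] [cite: DokchitserDokchitserAnnals2010, Thm. 1.4] -/
theorem X7.exists_kobayashiLowerDivisibility_three_of_lam_le_one_at_unitSign
    (h12 : Kobayashi2003.thm12_signedSelmerDual_finite_torsion)
    (h5 : realPeriodRat_eq_unit_mul_plusPeriod) (h3 : realPeriodRat_eq_unit_mul_plusPeriod_three)
    (hpar : p_parity W 3) (hX : ClassX7 W 3) (_hCM : ¬ W.HasCM) (hap : W.frobeniusTrace 3 = 0) (_hs : Surj W 3)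
    [NeZero (W.conductorNorm ℤ)] {f₀ : CuspForm (Gamma0 (W.conductorNorm ℤ)) 2} (hf₀ : IsNewformOf W f₀)
    (hlamU : ∀ (ε : ℤˣ) (L : IwasawaAlgebra 3), IsSignedPAdicLFunction f₀ 3 ε L → HasUnitContent L → lam L ≤ 1) :
    ∃ ε : ℤˣ, KobayashiLowerDivisibility W 3 ε :=
  Summit.BirchSwinnertonDyer.BirchSwinnertonDyer.Theorems.HorocycleMuFloor.exists_kobayashiLowerDivisibility_three_of_lam_le_one_at_unitSign
    W h12 h5 h3 hpar hX.1.1 hap hf₀ hlamU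

/-! ## §3. Odd `p`: the same from Conjecture B⁰ (used at `p ≥ 5`) or from the Teichmüller-orbit carrier -/

/-- **Odd good `p`, `a_p = 0`: `∃ ε, KobayashiLowerDivisibility W p ε` from the one-part certificate «`λ ≤ 1` at every
unit-content signed function», granted `h12`, `h5`, `h3`, `hpar`, and Conjecture B⁰ `TeichSpanGenAll`** (OPEN,
displayed; consumed only at `p ≥ 5` — at `p = 3` §2 is unconditional).
[cite: Kobayashi2003, Thm. 1.2 and Conjecture (p. 2)] [cite: DokchitserDokchitserAnnals2010, Thm. 1.4] [cite: Manin1972, Prop. 1.4] -/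
theorem exists_kobayashiLowerDivisibility_of_teichSpanGenAll_of_lam_le_one_at_unitSign (hB : TeichSpanGenAll)
    (h12 : Kobayashi2003.thm12_signedSelmerDual_finite_torsion)
    (h5 : realPeriodRat_eq_unit_mul_plusPeriod) (h3 : realPeriodRat_eq_unit_mul_plusPeriod_three)
    (hpar : p_parity W p) (hp2 : p ≠ 2) (hgood : W.HasGoodReductionAtPrime p) (hap : W.frobeniusTrace p = 0)
    [NeZero (W.conductorNorm ℤ)] {f₀ : CuspForm (Gamma0 (W.conductorNorm ℤ)) 2} (hf₀ : IsNewformOf W f₀)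
    (hlamU : ∀ (ε : ℤˣ) (L : IwasawaAlgebra p), IsSignedPAdicLFunction f₀ p ε L → HasUnitContent L → lam L ≤ 1) :
    ∃ ε : ℤˣ, KobayashiLowerDivisibility W p ε := by
  have hpP : p.Prime := Fact.out
  refine exists_kobayashiLowerDivisibility_of_rider_of_lam_le_one_at_unitSign W p h12 h5 h3 hpar hp2 hgood hap hf₀
    ?_ hlamU
  rcases Nat.lt_or_ge p 5 with hlt | hge
  · have hp3 : p = 3 := by
      have h2 := hpP.two_le
      interval_cases p
      · exact absurd rfl hp2
      · rfl
      · exact absurd hpP (by decide)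
    subst hp3
    exact exists_sign_hasUnitContent_three_of_isNewformOf f₀ hf₀ hgood hap
  · exact exists_sign_hasUnitContent_of_teichSpanGenAll f₀ hB hge hf₀ hgood hap

/-- **Odd good `p`, `a_p = 0`, B⁰-FREE**: the same from the per-curve carrier `TeichOrbitNonConstantAt W p`.
[cite: Kobayashi2003, Thm. 1.2 and Conjecture (p. 2)] [cite: DokchitserDokchitserAnnals2010, Thm. 1.4]
[cite: MazurTateTeitelbaum1986Invent, §I.10 (10.1)] -/
theorem exists_kobayashiLowerDivisibility_of_teichOrbitNonConstantAt_of_lam_le_one_at_unitSign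
    (h12 : Kobayashi2003.thm12_signedSelmerDual_finite_torsion)
    (h5 : realPeriodRat_eq_unit_mul_plusPeriod) (h3 : realPeriodRat_eq_unit_mul_plusPeriod_three)
    (hpar : p_parity W p) (hp2 : p ≠ 2) (hgood : W.HasGoodReductionAtPrime p) (hap : W.frobeniusTrace p = 0)
    (hT : TeichOrbitNonConstantAt W p)
    [NeZero (W.conductorNorm ℤ)] {f₀ : CuspForm (Gamma0 (W.conductorNorm ℤ)) 2} (hf₀ : IsNewformOf W f₀)
    (hlamU : ∀ (ε : ℤˣ) (L : IwasawaAlgebra p), IsSignedPAdicLFunction f₀ p ε L → HasUnitContent L → lam L ≤ 1) :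
    ∃ ε : ℤˣ, KobayashiLowerDivisibility W p ε :=
  exists_kobayashiLowerDivisibility_of_rider_of_lam_le_one_at_unitSign W p h12 h5 h3 hpar hp2 hgood hap hf₀
    (exists_sign_hasUnitContent_of_teichOrbitNonConstantAt f₀ hp2 hf₀ hgood hap hT) hlamU

/-- **The X7 corner, odd `p`, crux binders displayed** (`¬CM`, `Surj` idle): `∃ ε, KobayashiLowerDivisibility W p ε`
⟸ {`h12`, `h5`, `h3`, `hpar`, B⁰ (at `p ≥ 5`), the one-part certificate}. What this says about item 19001: on the
class, the open set is «`λ(L^ε_p) ≥ 2` at every unit-content sign» (granted B⁰ at `p ≥ 5`; unconditionally so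
described at `p = 3`). [cite: Kobayashi2003, Thm. 1.2 and Conjecture (p. 2)] [cite: DokchitserDokchitserAnnals2010, Thm. 1.4] -/
theorem X7.exists_kobayashiLowerDivisibility_of_teichSpanGenAll_of_lam_le_one_at_unitSign (hB : TeichSpanGenAll)
    (h12 : Kobayashi2003.thm12_signedSelmerDual_finite_torsion)
    (h5 : realPeriodRat_eq_unit_mul_plusPeriod) (h3 : realPeriodRat_eq_unit_mul_plusPeriod_three)
    (hpar : p_parity W p) (hp2 : p ≠ 2) (hX : ClassX7 W p) (_hCM : ¬ W.HasCM) (hap : W.frobeniusTrace p = 0)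
    (_hs : Surj W p)
    [NeZero (W.conductorNorm ℤ)] {f₀ : CuspForm (Gamma0 (W.conductorNorm ℤ)) 2} (hf₀ : IsNewformOf W f₀)
    (hlamU : ∀ (ε : ℤˣ) (L : IwasawaAlgebra p), IsSignedPAdicLFunction f₀ p ε L → HasUnitContent L → lam L ≤ 1) :
    ∃ ε : ℤˣ, KobayashiLowerDivisibility W p ε :=
  Summit.BirchSwinnertonDyer.BirchSwinnertonDyer.Theorems.HorocycleMuFloor.exists_kobayashiLowerDivisibility_of_teichSpanGenAll_of_lam_le_one_at_unitSign
    W p hB h12 h5 h3 hpar hp2 hX.1.1 hap hf₀ hlamU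

end Summit.BirchSwinnertonDyer.BirchSwinnertonDyer.Theorems.HorocycleMuFloor

end
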